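/-
VALUE = DECIDABLE VERDICT at p = 19 (one compiled evaluation of the certificate of
`ReflectionClassCertificateCode`), NOT summit progress (cell b2b-lgcu-borel, gen 23); the crux item
stmt-MatrixMultiplication-14079 is untouched.
-/
import Mathlib
import Summits.MatrixMultiplication.MatrixMultiplication.Theorems.SubgroupIdentityDesigns.Negative.ReflectionClassCertificateCode

/-!
# No member contains the square reflections of `𝔽₁₉^m`: the class `Ω₃(𝔽₁₉) × ⟨−1⟩`

VALUE = DECIDABLE VERDICT (`p = 19`, every `ε`, every `m ≥ 3`, no TPP, no budget), NOT summit
progress; the crux item stmt-MatrixMultiplication-14079 is untouched and remains open.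

THE CLASS.  `K = ⟨R_b : b·b a non-zero square⟩ = Ω₃(𝔽₁₉) × ⟨−1⟩ ≅ PSL₂(𝔽₁₉) × C₂`, order `6840`,
generated by the `190` square reflections of `(𝔽₁₉³, x² + y² + z²)`: the `p = 19` instance of the
`m = 3` reflection class of sign `−χ(−1)` (the square class, `19 ≡ 3 (mod 4)`), decided by the
code-tagged breadth-first certificate in 385 s (scratch check, rc 0).

THE VERDICT.  `cert_nineteen : certP (KSP (gens ws) 18) (gens ws) true ws 1 X₀ = true`
(`native_decide`; `X₀ = (0, 0, 1)` on the sphere `Q = 1`; `ws` = the three generator words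
`r_a r_b`, `r_b r_a`, `r_c` below, breadth-first depth `18`): the closure has the `6840` elements of
`K`, is closed, orthogonal with `det = ±1`, and every twisted-stabiliser orbit sum of the weight
`w(v) = χ(Q(v − X₀)) − χ(Q(v + X₀)) + 2χ(2v·X₀) + 19([v = X₀] − [v = −X₀])`
on the sphere vanishes while `w(X₀) = 16`.  By `ReflectionClassCertificateCode.no_design_sq_memᵢ_of_certP`:

THEOREMS `no_design_sq_mem₁/₂/₃_nineteen`: NO MEMBER OF A TRIPLE IN `GL_m(𝔽₁₉)`, `m ≥ 3`, CARRYING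
A LEVEL-ONE IDENTITY DESIGN CONTAINS ALL SQUARE REFLECTIONS OF `𝔽₁₉^m`.  With the files
for `p ≤ 17`: for `p ∈ {3, 5, 7, 11, 13, 17, 19}` no member contains all reflections of either square
class of `𝔽_p^m`, `m ≥ 3`; the open instances are `m = 3`, `p ≥ 23`, class of sign `−χ(−1)`.

HONEST SCOPE.  Configuration exclusion at `p = 19`; no `(p,m,ε)` cell is emptied.
-/

set_option linter.dupNamespace false

open scoped BigOperators Matrix

namespace Summit.MatrixMultiplication.MatrixMultiplication.Theorems.SubgroupIdentityDesigns.Negative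
namespace SquareReflectionsNineteen

open Summit.MatrixMultiplication.MatrixMultiplication.Theorems.LieRankDesigns.Negative (GLm Mat)
open NonsquareReflections (refl)
open ReflectionClassCertificate (V)
open ReflectionClassCertificateBFS (gens)
open ReflectionClassCertificateCode (KSP certP no_design_sq_mem₁_of_certP no_design_sq_mem₂_of_certP
  no_design_sq_mem₃_of_certP)

/-- `19` is prime (instance for the level vocabulary at `p = 19`). -/
instance fact_prime_nineteen : Fact (Nat.Prime 19) := ⟨by norm_num⟩

/-- The base point `X₀ = (0, 0, 1)` of the sphere `Q = 1` in `𝔽₁₉³`. -/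
def X₀ : V 19 := ![0, 0, 1]

/-- The generator words: `r_a r_b`, its inverse `r_b r_a`, and one reflection `r_c` (all three
vectors have `b·b` a non-zero square mod `19`). -/
def ws : List (List (V 19)) :=
  [[![1, 2, 17], ![1, 15, 16]], [![1, 15, 16], ![1, 2, 17]], [![1, 0, 14]]]

/-- **THE CERTIFICATE OF THE SQUARE CLASS AT `p = 19`, EVALUATED.** -/
theorem cert_nineteen : certP (KSP (gens ws) 18) (gens ws) true ws 1 X₀ = true := by
  native_decide

variable {m : ℕ} {H₁ H₂ H₃ : Subgroup (GLm 19 m)}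

/-- **NO MEMBER OF A TRIPLE IN `GL_m(𝔽₁₉)`, `m ≥ 3`, WITH A LEVEL-ONE IDENTITY DESIGN CONTAINS ALL
SQUARE REFLECTIONS OF `𝔽₁₉^m`**: member `1`. -/
theorem no_design_sq_mem₁_nineteen (hm : 3 ≤ m)
    (h₁ : ∀ b : Fin m → ZMod 19, b ⬝ᵥ b ≠ 0 → IsSquare (b ⬝ᵥ b) → refl b ∈ H₁) :
    ¬ ∃ c : Mat 19 m → ℂ, (∀ M, 1 < M.rank → c M = 0) ∧
      (∑ M, c M * ZMod.stdAddChar (Matrix.trace (M * ((1 : GLm 19 m) : Mat 19 m)))) = 1 ∧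
      ∀ a ∈ H₁, ∀ b ∈ H₂, ∀ g ∈ H₃, a * b * g ≠ 1 →
        (∑ M, c M * ZMod.stdAddChar (Matrix.trace (M * ((a * b * g : GLm 19 m) : Mat 19 m)))) = 0 :=
  no_design_sq_mem₁_of_certP cert_nineteen hm h₁

/-- Member `2`. -/
theorem no_design_sq_mem₂_nineteen (hm : 3 ≤ m)
    (h₂ : ∀ b : Fin m → ZMod 19, b ⬝ᵥ b ≠ 0 → IsSquare (b ⬝ᵥ b) → refl b ∈ H₂) :
    ¬ ∃ c : Mat 19 m → ℂ, (∀ M, 1 < M.rank → c M = 0) ∧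
      (∑ M, c M * ZMod.stdAddChar (Matrix.trace (M * ((1 : GLm 19 m) : Mat 19 m)))) = 1 ∧
      ∀ a ∈ H₁, ∀ b ∈ H₂, ∀ g ∈ H₃, a * b * g ≠ 1 →
        (∑ M, c M * ZMod.stdAddChar (Matrix.trace (M * ((a * b * g : GLm 19 m) : Mat 19 m)))) = 0 :=
  no_design_sq_mem₂_of_certP cert_nineteen hm h₂

/-- Member `3`. -/
theorem no_design_sq_mem₃_nineteen (hm : 3 ≤ m)
    (h₃ : ∀ b : Fin m → ZMod 19, b ⬝ᵥ b ≠ 0 → IsSquare (b ⬝ᵥ b) → refl b ∈ H₃) :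
    ¬ ∃ c : Mat 19 m → ℂ, (∀ M, 1 < M.rank → c M = 0) ∧
      (∑ M, c M * ZMod.stdAddChar (Matrix.trace (M * ((1 : GLm 19 m) : Mat 19 m)))) = 1 ∧
      ∀ a ∈ H₁, ∀ b ∈ H₂, ∀ g ∈ H₃, a * b * g ≠ 1 →
        (∑ M, c M * ZMod.stdAddChar (Matrix.trace (M * ((a * b * g : GLm 19 m) : Mat 19 m)))) = 0 :=
  no_design_sq_mem₃_of_certP cert_nineteen hm h₃

end SquareReflectionsNineteen
end Summit.MatrixMultiplication.MatrixMultiplication.Theorems.SubgroupIdentityDesigns.Negative
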